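import Summits.CriticalPhenomena.Ising3D.TaylorTableEvenHeadFast
import Summits.CriticalPhenomena.Ising3D.TaylorRegionDeltaLitEven
import Mathlib.Tactic.Linarith
import Mathlib.Tactic.Positivity
import Mathlib.Tactic.Ring
import HarnessLib

/-!
# The TABLE layer of a derivative certificate, XIX: δ-expanded ROW TRIPLES for the head layer (contract + discharge from the literal δ-tables)
(cell `pub-ising3x`, seat boot-1 gen 8; gate (g2) — the head layer's "late boxing", rows half)

HONEST FRAMING: lottery ticket; floor = tightest certified 3D Ising CFT bounds; no exact-solution
claim without a proof. Island framing: certified exclusion region at stated derivative order and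
assumptions; not a determination of the 3D Ising critical exponents beyond that.

MEASURED (boot-1 g7, COST-HEAD-KERNEL.md §2 (iv); recog-1 g12/g13): zeroth-order interval rows (`EvenRows.Valid/ValidE`:
the `(Δσ, Δε)`-dependence of the q-rows collapsed to intervals FIRST) have 10–100 % relative width already at box
half-width 1.5·10⁻⁴ (cancellation across the alternating-sign Taylor weights) — adequate for point boxes only. recog-1's
δ-EXPANSION (TaylorSigmaDelta / TaylorKernelPDDelta / TaylorRegionDeltaRows: `q̂(E, j; s₀ + δ) = R₀(E) + δ·R₁(E) + δ²·R₂(δ)(E)`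
with interval row TRIPLES from literal δ-tables, `qSum_eq_delta_rows`, `pmem3_tripL`) made the REGION layer box-width
robust (half-width 2·10⁻³). This file states the head layer's row contract on those triples and discharges it from the
SAME literal data a wide-box region certificate already carries:
* `HeadRowsΔ` — scale, usable row count `J`, box centres / half-widths, and the literal row triples `L`
  (row `j ↦ (X-triple, Y-triple, Z-triple)`, plain variable `E`, i.e. `ccQ = 0` — recog-1's convention);
* `HeadRowsΔ.ValidΔ` — existential contract: for every `(Δσ, Δε)` of the box and `j < J` SOME real triple in `L[j]`
  whose `val3` (`r₀(E) + δ r₁(E) + δ² r₂(E)`) is the q-sum `X̂(E, j)` (`δ = Δσ − σ0`), resp. `Ŷ` (`δ = Δε − ε0`),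
  `Ẑ₋ + Ẑ₊` (`δ = s̄ − b0`);
* **`HeadRowsΔ.validΔ_of_lit`** — `EvenRegionDataΔ.tabOKc` (4 components × 3 orders), `rowLitOKL` for `j < J`,
  `sizesOK`, `ccQ = 0` ⇒ `ValidΔ` for the certificate's literal `L` (rows shared by region and head layers).
The cell theorem consuming `ValidΔ` is `evenHead_nonneg_of_partsΔ` (TaylorTableEvenHeadDelta). No new mathematics.
Sources: Kos–Poland–Simmons-Duffin 2014 §3.3 eq. (3.16); Moore 1966 Ch. 3. [folklore]
-/

namespace Summit.CriticalPhenomena.Ising3D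

open Finset Set
open Literature.Analysis.ValidatedNumerics Literature.Analysis.ValidatedNumerics.PolyMP
open Literature.Analysis.ValidatedNumerics.NumericsMP (MI)
open Literature.MathematicalPhysics.QuantumFieldTheory.ConformalBootstrap3D

/-! ### Part 2. δ-expanded row triples for the head layer -/

/-- Row data of the δ-expanded head layer: scale, number of usable rows `J`, the box centres / half-widths in `Δσ` and
`Δε`, and the literal row TRIPLES `L` (row `j ↦ (X-triple, Y-triple, Z-triple)`, each triple `(R₀, R₁, R₂)` in the
plain variable `E`) — the SAME literal a wide-box region certificate carries (`EvenRegionDataΔ.rowLitOKL`, `ccQ = 0`).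
[folklore] -/
structure HeadRowsΔ where
  /-- fixed-point scale -/
  S : ℕ
  /-- rows `j < J` are usable -/
  J : ℕ
  /-- centre of the box in `Δσ` -/
  σ0 : ℚ
  /-- half-width of the box in `Δσ` -/
  Wσ : ℚ
  /-- centre of the box in `Δε` -/
  ε0 : ℚ
  /-- half-width of the box in `Δε` -/
  Wε : ℚ
  /-- literal row triples -/
  L : List (ITriple × ITriple × ITriple)

namespace HeadRowsΔ

variable (R : HeadRowsΔ)

/-- centre in `s̄ = (Δσ + Δε)/2` -/
def b0 : ℚ := (R.σ0 + R.ε0) / 2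
/-- half-width in `s̄` -/
def Wb : ℚ := (R.Wσ + R.Wε) / 2
/-- order-0 rows of `X̂` -/
def RX0 : List IPoly := R.L.map fun t => t.1.1
/-- order-1 rows of `X̂` -/
def RX1 : List IPoly := R.L.map fun t => t.1.2.1
/-- order-2 rows of `X̂` -/
def RX2 : List IPoly := R.L.map fun t => t.1.2.2
/-- order-0 rows of `Ŷ` -/
def RY0 : List IPoly := R.L.map fun t => t.2.1.1
/-- order-1 rows of `Ŷ` -/
def RY1 : List IPoly := R.L.map fun t => t.2.1.2.1
/-- order-2 rows of `Ŷ` -/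
def RY2 : List IPoly := R.L.map fun t => t.2.1.2.2
/-- order-0 rows of `Ẑ` -/
def RZ0 : List IPoly := R.L.map fun t => t.2.2.1
/-- order-1 rows of `Ẑ` -/
def RZ1 : List IPoly := R.L.map fun t => t.2.2.2.1
/-- order-2 rows of `Ẑ` -/
def RZ2 : List IPoly := R.L.map fun t => t.2.2.2.2

/-- The order-`m` rows viewed as `EvenRows` (so that the landed part machinery applies order by order). [folklore] -/
def rows0 : EvenRows := ⟨R.S, R.J, R.RX0, R.RY0, R.RZ0⟩
/-- See `rows0`. [folklore] -/
def rows1 : EvenRows := ⟨R.S, R.J, R.RX1, R.RY1, R.RZ1⟩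
/-- See `rows0`. [folklore] -/
def rows2 : EvenRows := ⟨R.S, R.J, R.RX2, R.RY2, R.RZ2⟩

/-- **δ-row validity** (the contract): positive scale, nonnegative half-widths, and for every `(Δσ, Δε)` of the box:
`|Δσ − σ0| ≤ Wσ`, `|Δε − ε0| ≤ Wε`, and for every `j < J` SOME real triple in the carried literal row triple whose value
`r₀(E) + δ·r₁(E) + δ²·r₂(E)` (`val3`) is the q-sum `X̂(E, j)` with `δ = Δσ − σ0` (resp. `Ŷ` with `δ = Δε − ε0`,
`Ẑ₋ + Ẑ₊` with `δ = s̄ − b0`). [folklore] -/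
def ValidΔ (c : Fin 5 → ℕ × ℕ → ℚ) (Lx : List (ℕ × ℕ)) (σlo σhi εlo εhi : ℚ) : Prop :=
  0 < R.S ∧ 0 ≤ R.Wσ ∧ 0 ≤ R.Wε ∧
  ∀ p ∈ Icc (σlo : ℝ) σhi ×ˢ Icc (εlo : ℝ) εhi, |p.1 - R.σ0| ≤ R.Wσ ∧ |p.2 - R.ε0| ≤ R.Wε ∧
    ∀ j < R.J,
      (∃ r : List ℝ × List ℝ × List ℝ, PMem3 R.S r (R.L.getD j EvenRegionDataΔ.noLit3).1 ∧
        ∀ E : ℝ, qSum (fun ab => (c 0 ab : ℝ)) Lx.toFinset p.1 (-1) E j = val3 r E (p.1 - R.σ0)) ∧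
      (∃ r : List ℝ × List ℝ × List ℝ, PMem3 R.S r (R.L.getD j EvenRegionDataΔ.noLit3).2.1 ∧
        ∀ E : ℝ, qSum (fun ab => (c 1 ab : ℝ)) Lx.toFinset p.2 (-1) E j = val3 r E (p.2 - R.ε0)) ∧
      (∃ r : List ℝ × List ℝ × List ℝ, PMem3 R.S r (R.L.getD j EvenRegionDataΔ.noLit3).2.2 ∧
        ∀ E : ℝ, qSum (fun ab => (c 3 ab : ℝ)) Lx.toFinset ((p.1 + p.2) / 2) (-1) E j +
          qSum (fun ab => (c 4 ab : ℝ)) Lx.toFinset ((p.1 + p.2) / 2) 1 E j = val3 r E ((p.1 + p.2) / 2 - R.b0))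

/-- Reading the projected row lists off the literal. [folklore] -/
theorem getD_proj (f : ITriple × ITriple × ITriple → IPoly) (hf : f EvenRegionDataΔ.noLit3 = []) (j : ℕ) :
    (R.L.map f).getD j [] = f (R.L.getD j EvenRegionDataΔ.noLit3) := by
  rw [← hf, List.getD_map]

/-- **`ValidΔ` from the literal δ-tables of a wide-box region certificate**: the table containments `tabOKc`
(4 components × 3 orders, one declaration each), the row containments `rowLitOKL` for `j < J`, the sizes Boolean, and
`ccQ = 0` ⇒ the head-row contract for the literal `L` (rows shared with the region layer). [folklore] -/
theorem validΔ_of_lit (d : EvenRegionDataΔ) (TT : ITab3 × ITab3 × ITab3 × ITab3)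
    (L : List (ITriple × ITriple × ITriple)) (J : ℕ) (hl : d.l.Nodup) (hs : d.sizesOK = true) (hcc : d.ccQ = 0)
    (hT : ∀ c m : ℕ, c < 4 → m < 3 → d.tabOKc TT c m = true) (hr : ∀ j : ℕ, j < J → d.rowLitOKL TT L j = true) :
    (⟨d.S, J, d.σ0, d.Wσ, d.ε0, d.Wε, L⟩ : HeadRowsΔ).ValidΔ d.cQ d.l d.σlo d.σhi d.εlo d.εhi := by
  simp only [EvenRegionDataΔ.sizesOK, EvenRegionDataH.sizesOK, Bool.and_eq_true, decide_eq_true_eq] at hs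
  obtain ⟨⟨⟨⟨⟨⟨⟨⟨⟨⟨⟨⟨⟨⟨⟨⟨⟨hS, _⟩, _⟩, _⟩, _⟩, _⟩, _⟩, _⟩, _⟩, _⟩, _⟩, _⟩, hσ⟩, hε⟩,
    hZX⟩, hZY⟩, hZ3⟩, hZ4⟩ := hs
  have hS : 0 < d.S := hS
  have hWσ : 0 ≤ d.Wσ := by unfold EvenRegionDataΔ.Wσ; linarith
  have hWε : 0 ≤ d.Wε := by unfold EvenRegionDataΔ.Wε; linarith
  have hWb : 0 ≤ d.Wb := by unfold EvenRegionDataΔ.Wb; linarith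
  have tX : ∀ m : ℕ, m < 3 → tabOK d.S (d.cQ 0) (-1) d.σ0 d.Wσ d.ccQ d.l TT.1 m = true :=
    fun m hm => hT 0 m (by norm_num) hm
  have tY : ∀ m : ℕ, m < 3 → tabOK d.S (d.cQ 1) (-1) d.ε0 d.Wε d.ccQ d.l TT.2.1 m = true :=
    fun m hm => hT 1 m (by norm_num) hm
  have t3 : ∀ m : ℕ, m < 3 → tabOK d.S (d.cQ 3) (-1) d.b0 d.Wb d.ccQ d.l TT.2.2.1 m = true :=
    fun m hm => hT 2 m (by norm_num) hm
  have t4 : ∀ m : ℕ, m < 3 → tabOK d.S (d.cQ 4) 1 d.b0 d.Wb d.ccQ d.l TT.2.2.2 m = true :=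
    fun m hm => hT 3 m (by norm_num) hm
  refine ⟨hS, hWσ, hWε, fun p hp => ?_⟩
  obtain ⟨h1, h2, h3, h4⟩ : (d.σlo : ℝ) ≤ p.1 ∧ p.1 ≤ d.σhi ∧ (d.εlo : ℝ) ≤ p.2 ∧ p.2 ≤ d.εhi := by
    simp only [Set.mem_prod, Set.mem_Icc] at hp; exact ⟨hp.1.1, hp.1.2, hp.2.1, hp.2.2⟩
  have hδσ : |p.1 - d.σ0| ≤ d.Wσ := by
    unfold EvenRegionDataΔ.σ0 EvenRegionDataΔ.Wσ; push_cast; rw [abs_le]; constructor <;> linarith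
  have hδε : |p.2 - d.ε0| ≤ d.Wε := by
    unfold EvenRegionDataΔ.ε0 EvenRegionDataΔ.Wε; push_cast; rw [abs_le]; constructor <;> linarith
  have hδb : |(p.1 + p.2) / 2 - d.b0| ≤ d.Wb := by
    unfold EvenRegionDataΔ.b0 EvenRegionDataΔ.Wb EvenRegionDataΔ.σ0 EvenRegionDataΔ.Wσ EvenRegionDataΔ.ε0
      EvenRegionDataΔ.Wε
    push_cast; rw [abs_le]; constructor <;> linarith
  refine ⟨hδσ, hδε, fun j hj => ?_⟩
  -- the four q-sums as triples (`ccQ = 0`)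
  have hcc' : ((d.ccQ : ℚ) : ℝ) = 0 := by rw [hcc]; push_cast; rfl
  have eX := qSum_eq_delta_rows hS (d.cQ 0) (-1) d.σ0 hWσ d.ccQ hl hZX hδσ
  have eY := qSum_eq_delta_rows hS (d.cQ 1) (-1) d.ε0 hWε d.ccQ hl hZY hδε
  have eZ3 := qSum_eq_delta_rows hS (d.cQ 3) (-1) d.b0 hWb d.ccQ hl hZ3 hδb
  have eZ4 := qSum_eq_delta_rows hS (d.cQ 4) 1 d.b0 hWb d.ccQ hl hZ4 hδb
  have aσ : ((d.σ0 : ℚ) : ℝ) + (p.1 - d.σ0) = p.1 := by ring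
  have aε : ((d.ε0 : ℚ) : ℝ) + (p.2 - d.ε0) = p.2 := by ring
  have ab : ((d.b0 : ℚ) : ℝ) + ((p.1 + p.2) / 2 - d.b0) = (p.1 + p.2) / 2 := by ring
  rw [aσ] at eX; rw [aε] at eY; rw [ab] at eZ3 eZ4
  simp only [Rat.cast_neg, Rat.cast_one, hcc', sub_zero] at eX eY eZ3 eZ4
  -- memberships of the real triples in the triples from the literal tables, then in the literal rows
  have qX := pmem3_tripL hS (d.cQ 0) (-1) d.σ0 hWσ d.ccQ d.l tX d.N j hδσ
  have qY := pmem3_tripL hS (d.cQ 1) (-1) d.ε0 hWε d.ccQ d.l tY d.N j hδε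
  have q3 := pmem3_tripL hS (d.cQ 3) (-1) d.b0 hWb d.ccQ d.l t3 d.N j hδb
  have q4 := pmem3_tripL hS (d.cQ 4) 1 d.b0 hWb d.ccQ d.l t4 d.N j hδb
  have qZ := pmem3_add q3 q4
  have hrow := hr j hj
  simp only [EvenRegionDataΔ.rowLitOKL, EvenRegionDataΔ.rowLitRowOK, Bool.and_eq_true] at hrow
  obtain ⟨⟨sX, sY⟩, sZ⟩ := hrow
  have mX := pmem3_of_subset3 qX sX
  have mY := pmem3_of_subset3 qY sY
  have mZ := pmem3_of_subset3 qZ sZ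
  refine ⟨⟨_, mX, fun E => ?_⟩, ⟨_, mY, fun E => ?_⟩, ⟨_, mZ, fun E => ?_⟩⟩
  · rw [eX E j]; simp only [val3]
  · rw [eY E j]; simp only [val3]
  · rw [eZ3 E j, eZ4 E j, show (⟨d.S, J, d.σ0, d.Wσ, d.ε0, d.Wε, L⟩ : HeadRowsΔ).b0 = d.b0 from rfl]
    simp only [val3, evalR_addR]; ring

end HeadRowsΔ

end Summit.CriticalPhenomena.Ising3D
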